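import Summits.QuantumFields.YangMills.Theorems.SwapVirialDeficitBlowUpPeriodicTwoScaleJoint
import Summits.QuantumFields.YangMills.Theorems.SwapVirialDeficitBlowUpPeriodicTwoScaleChartLevel
import HarnessLib

/-!
# The PERIODIC massive-mode rung, brick PM-V: POSITIVITY of the two-scale limit profile — `Φ` vanishes at the real abelian configuration, so `{Φ(0,0;a₀,·) < r}` has positive volume
# (free-hands support of ⟨stmt-QuantumFields-24196⟩ `SwapVirialDeficit.ToronSoftnessSharp`; the `∫M > 0` input of ✓`relativeGap_fixedL_of_twoScaleLimit[_level]` / LEAD ym-line-sfw-p2 g96's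
# a₀-averaged (A), for ANY level `r > 0` and EVERY hub `a₀ ≠ 0`)

At the configuration `ξ⋆ = (((c,c),c), f ↦ c)` of REAL letters (`0 < c < 1`; every raw two-scale letter is then the real quaternion `c`, i.e. the identity of `SU(2)`, and the hub
letter commutes with everything) the two-scale deficit vanishes identically in `(u, s)` (✓`periodicChartDeficit_eq_zero_of_comm`), hence `Φ(u,s;a₀,ξ⋆) = 0` for `u, s ≠ 0`
(✓`twoScaleDeficit_eq_pow_four_mul_sq_phi`) and `Φ(0,0;a₀,ξ⋆) = 0` by joint continuity (✓`continuousOn_twoScalePhi`).  Consequently, for every `r > 0`, an OPEN neighbourhood of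
`ξ⋆` lies in `{all real parts in (0,1)} ∩ {Φ(0,0;a₀,·) < r}`, which therefore has POSITIVE `vol³ ⊗ vol^{Fol}`-measure (★★★ `measure_pos_of_phi_lt`); and a measurable bounded
profile that is positive at every `a₀ ∈ (−1,1)∖{0}` has `0 < (∫⁻_{(−1,1)} 4π·M).toReal` (★ `toReal_lintegral_pos_of_pos`).
HONEST LABEL: plumbing for a plan-level fixed-`L` rung of a DRAFT line; ⟨24196⟩/⟨24497⟩ OPEN; own crux ⟨22884⟩ OPEN (blocked-on ⟨19935⟩); the Yang–Mills mass gap is NOT proved;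
no summit is proved by a line.  Width seat ym-line-sfw-p2-w3 g64 (cell ym-idea-1, free hands), `--supports stmt-QuantumFields-24196`.  THEOREMS ONLY (0 `def`, 0 `sorry`),
standard axioms.  References: [cite: Luscher1983, §2]; [cite: GonzalezarroyoAltes1988]; [folklore].
-/

set_option autoImplicit false

noncomputable section

open MeasureTheory Quaternion Set Filter Topology
open scoped Quaternion ENNReal
open Literature.MathematicalPhysics.QuantumLattice
open Literature.MathematicalPhysics.QuantumFieldTheory hiding SU2
open Summit.QuantumFields.YangMills.Theorems.SwapTwistDeficit.ToronLog

attribute [local instance] Literature.Analysis.FluidPDE.Tao2016.quatMeasurableSpace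
  Literature.Analysis.FluidPDE.Tao2016.quatBorelSpace
  Literature.MathematicalPhysics.QuantumLattice.secondCountableTopology_su2

namespace Summit.QuantumFields.YangMills.Theorems.SwapVirialDeficit.BlowUpRing

open Summit.QuantumFields.YangMills.Theorems.FemtoTransferGap
open Summit.QuantumFields.YangMills.Theorems.FemtoTransferGap.TT
open Summit.QuantumFields.YangMills.Theorems.SwapVirialDeficit.ZeroModeSigma (dilateIm dilateIm_apply)
open Summit.QuantumFields.YangMills.Theorems.WeakCouplingRates (quatToSU2_one)

variable {L : ℕ} [NeZero L]

/-! ## §1 The real abelian configuration -/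

omit [NeZero L] in
/-- A real raw letter stays real under the two-scale map: `twoScaleRaw u s c = c`. [folklore] -/
theorem twoScaleRaw_coe (u s c : ℝ) : twoScaleRaw u s (c : ℍ) = (c : ℍ) := by
  ext <;> simp [twoScaleRaw]

omit [NeZero L] in
/-- A real follower stays real under `dilateIm`: `dilateIm τ c = c`. [folklore] -/
theorem dilateIm_coe (τ c : ℝ) : dilateIm τ (c : ℍ) = (c : ℍ) := by
  ext <;> simp [dilateIm_apply]

omit [NeZero L] in
/-- A positive real letter is the identity of `SU(2)`: `Q(twoScaleRaw u s c) = 1` (`c > 0`). [folklore] -/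
theorem quatToSU2_twoScaleRaw_coe (u s : ℝ) {c : ℝ} (hc : 0 < c) : quatToSU2 (twoScaleRaw u s (c : ℍ)) = 1 := by
  rw [twoScaleRaw_coe, show ((c : ℝ) : ℍ) = c • (1 : ℍ) by rw [Algebra.smul_def, mul_one]; rfl, quatToSU2_smul hc, quatToSU2_one]

omit [NeZero L] in
/-- Positive real followers are the identity: `twoScaleFollowers L τ (f ↦ c) = 1`. [folklore] -/
theorem twoScaleFollowers_coe (τ : ℝ) {c : ℝ} (hc : 0 < c) : twoScaleFollowers L τ (fun _ : Fol L => (c : ℍ)) = fun _ => 1 := by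
  funext i
  simp only [twoScaleFollowers, dilateIm_coe]
  rw [show ((c : ℝ) : ℍ) = c • (1 : ℍ) by rw [Algebra.smul_def, mul_one]; rfl, quatToSU2_smul hc, quatToSU2_one]

/-- ★ **The two-scale deficit VANISHES identically at the real configuration** `ξ⋆ = (((c,c),c), f ↦ c)`, `c > 0`, for all `(u, s, a₀)`:
three identity leaders, identity followers, and the hub letter commute pairwise (✓`periodicChartDeficit_eq_zero_of_comm`). [cite: Luscher1983, §2] -/
theorem twoScaleDeficit_coe_eq_zero {c : ℝ} (hc : 0 < c) (u s a₀ : ℝ) :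
    twoScaleDeficit L u s a₀ ((((c : ℍ), (c : ℍ)), (c : ℍ))) (fun _ : Fol L => (c : ℍ)) = 0 := by
  unfold twoScaleDeficit
  rw [twoScaleFollowers_coe (L := L) (u ^ 2 * s) hc]
  refine periodicChartDeficit_eq_zero_of_comm _ fun μ ν => ?_
  have h1 : quatToSU2 (twoScaleRaw u s (c : ℍ)) = 1 := quatToSU2_twoScaleRaw_coe u s hc
  fin_cases μ <;> fin_cases ν <;> simp [twoScaleLeaders, h1]

/-- ★ `Φ(u, s; a₀, ξ⋆) = 0` for `u, s ≠ 0` (from `G = u⁴s²Φ` at a non-degenerate point). [folklore] -/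
theorem twoScalePhi_coe_eq_zero {c : ℝ} (hc : 0 < c) {a₀ : ℝ} (ha₀ : a₀ ≠ 0) {u s : ℝ} (hu : u ≠ 0) (hs : s ≠ 0) :
    twoScalePhi L u s a₀ ((((c : ℍ), (c : ℍ)), (c : ℍ))) (fun _ : Fol L => (c : ℍ)) = 0 := by
  have hc0 : ((c : ℝ) : ℍ).re ≠ 0 := by simpa using hc.ne'
  have hG := twoScaleDeficit_eq_pow_four_mul_sq_phi (L := L) (w' := (((c : ℍ), (c : ℍ)), (c : ℍ))) (y := fun _ : Fol L => (c : ℍ))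
    (a₀ := a₀) hc0 hc0 hc0 ha₀ (fun _ => by simpa using hc) u s
  rw [twoScaleDeficit_coe_eq_zero hc] at hG
  have hus : u ^ 4 * s ^ 2 ≠ 0 := by positivity
  rcases mul_eq_zero.1 hG.symm with h | h
  · exact absurd h hus
  · exact h

/-- The slice map `q ↦ (q.1, q.2, a₀, ξ)` lands in the good set when `ξ⋆`'s real parts are non-zero; `Φ` is continuous along it. [folklore] -/
theorem continuousAt_twoScalePhi_pair {a₀ : ℝ} (ha₀ : a₀ ≠ 0) {w' : (ℍ × ℍ) × ℍ} {y : Fol L → ℍ} (hx : w'.1.1.re ≠ 0) (hy' : w'.1.2.re ≠ 0)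
    (hz : w'.2.re ≠ 0) (hf : ∀ i, (y i).re ≠ 0) (q₀ : ℝ × ℝ) :
    ContinuousAt (fun q : ℝ × ℝ => twoScalePhi L q.1 q.2 a₀ w' y) q₀ := by
  have hmem : ((q₀.1, q₀.2, a₀, w', y) : TwoScaleParam L) ∈ {p : TwoScaleParam L | p.2.2 ∈ sliceGood L} := by
    show ((a₀, w', y) : ℝ × ((ℍ × ℍ) × ℍ) × (Fol L → ℍ)) ∈ sliceGood L
    exact mem_sliceGood ha₀ hx hy' hz hf
  have hopen : IsOpen {p : TwoScaleParam L | p.2.2 ∈ sliceGood L} := isOpen_sliceGood.preimage (continuous_snd.comp continuous_snd)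
  have hcont := continuousOn_twoScalePhi.continuousAt (hopen.mem_nhds hmem)
  have hι : Continuous fun q : ℝ × ℝ => ((q.1, q.2, a₀, w', y) : TwoScaleParam L) :=
    continuous_fst.prodMk (continuous_snd.prodMk continuous_const)
  have e : (fun q : ℝ × ℝ => twoScalePhi L q.1 q.2 a₀ w' y) =
      (fun p : TwoScaleParam L => twoScalePhi L p.1 p.2.1 p.2.2.1 p.2.2.2.1 p.2.2.2.2) ∘ (fun q : ℝ × ℝ => ((q.1, q.2, a₀, w', y) : TwoScaleParam L)) := rfl
  rw [e]
  exact ContinuousAt.comp hcont hι.continuousAt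

/-- `Φ` is continuous in the fibre variable `ξ = (w', y)` at good points, `(u, s, a₀)` fixed. [folklore] -/
theorem continuousAt_twoScalePhi_fibre (u s : ℝ) {a₀ : ℝ} (ha₀ : a₀ ≠ 0) {ξ : ((ℍ × ℍ) × ℍ) × (Fol L → ℍ)} (hx : ξ.1.1.1.re ≠ 0)
    (hy' : ξ.1.1.2.re ≠ 0) (hz : ξ.1.2.re ≠ 0) (hf : ∀ i, (ξ.2 i).re ≠ 0) :
    ContinuousAt (fun ξ' : ((ℍ × ℍ) × ℍ) × (Fol L → ℍ) => twoScalePhi L u s a₀ ξ'.1 ξ'.2) ξ := by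
  have hmem : ((u, s, a₀, ξ.1, ξ.2) : TwoScaleParam L) ∈ {p : TwoScaleParam L | p.2.2 ∈ sliceGood L} := by
    show ((a₀, ξ.1, ξ.2) : ℝ × ((ℍ × ℍ) × ℍ) × (Fol L → ℍ)) ∈ sliceGood L
    exact mem_sliceGood ha₀ hx hy' hz hf
  have hopen : IsOpen {p : TwoScaleParam L | p.2.2 ∈ sliceGood L} := isOpen_sliceGood.preimage (continuous_snd.comp continuous_snd)
  have hcont := continuousOn_twoScalePhi.continuousAt (hopen.mem_nhds hmem)
  have hι : Continuous fun ξ' : ((ℍ × ℍ) × ℍ) × (Fol L → ℍ) => ((u, s, a₀, ξ'.1, ξ'.2) : TwoScaleParam L) :=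
    continuous_const.prodMk (continuous_const.prodMk (continuous_const.prodMk (continuous_fst.prodMk continuous_snd)))
  have e : (fun ξ' : ((ℍ × ℍ) × ℍ) × (Fol L → ℍ) => twoScalePhi L u s a₀ ξ'.1 ξ'.2) =
      (fun p : TwoScaleParam L => twoScalePhi L p.1 p.2.1 p.2.2.1 p.2.2.2.1 p.2.2.2.2) ∘
        (fun ξ' : ((ℍ × ℍ) × ℍ) × (Fol L → ℍ) => ((u, s, a₀, ξ'.1, ξ'.2) : TwoScaleParam L)) := rfl
  rw [e]
  exact ContinuousAt.comp hcont hι.continuousAt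

/-- ★★ **`Φ(0, 0; a₀, ξ⋆) = 0`** (`a₀ ≠ 0`): the limit profile vanishes at the real abelian configuration. [cite: Luscher1983, §2] -/
theorem twoScalePhi_zero_zero_coe {c : ℝ} (hc : 0 < c) {a₀ : ℝ} (ha₀ : a₀ ≠ 0) :
    twoScalePhi L 0 0 a₀ ((((c : ℍ), (c : ℍ)), (c : ℍ))) (fun _ : Fol L => (c : ℍ)) = 0 := by
  have hc0 : ((c : ℝ) : ℍ).re ≠ 0 := by simpa using hc.ne'
  have hcont := continuousAt_twoScalePhi_pair (L := L) ha₀ (w' := (((c : ℍ), (c : ℍ)), (c : ℍ))) (y := fun _ : Fol L => (c : ℍ))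
    hc0 hc0 hc0 (fun _ => hc0) ((0 : ℝ), (0 : ℝ))
  -- along the diagonal `u ↦ (u, u)`, `u ≠ 0`, `Φ = 0`
  have hdiag : Tendsto (fun u : ℝ => twoScalePhi L u u a₀ ((((c : ℍ), (c : ℍ)), (c : ℍ))) (fun _ : Fol L => (c : ℍ))) (𝓝[≠] (0 : ℝ))
      (𝓝 (twoScalePhi L 0 0 a₀ ((((c : ℍ), (c : ℍ)), (c : ℍ))) (fun _ : Fol L => (c : ℍ)))) := by
    have h := hcont.tendsto.comp ((continuous_id.prodMk continuous_id).continuousAt (x := (0 : ℝ))).tendsto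
    exact h.mono_left nhdsWithin_le_nhds
  have hzero : (fun u : ℝ => twoScalePhi L u u a₀ ((((c : ℍ), (c : ℍ)), (c : ℍ))) (fun _ : Fol L => (c : ℍ))) =ᶠ[𝓝[≠] (0 : ℝ)] fun _ => 0 :=
    eventually_nhdsWithin_of_forall fun u hu => twoScalePhi_coe_eq_zero hc ha₀ hu hu
  exact tendsto_nhds_unique (hdiag.congr' hzero) tendsto_const_nhds

/-! ## §2 Positive volume of `{Φ(0,0;a₀,·) < r}` and positivity of `∫M` -/

/-- ★★★ **POSITIVE VOLUME**: for `r > 0`, `a₀ ≠ 0`, any set containing every fibre point with all real parts in `(0, 1)` and `Φ(0,0;a₀,ξ) < r` has positive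
`vol³ ⊗ vol^{Fol}`-measure (it contains an open neighbourhood of `ξ⋆` with `c = 1/2`). [cite: Luscher1983, §2] -/
theorem measure_pos_of_phi_lt {r : ℝ} (hr : 0 < r) {a₀ : ℝ} (ha₀ : a₀ ≠ 0) {S : Set (((ℍ × ℍ) × ℍ) × (Fol L → ℍ))}
    (hS : ∀ ξ : ((ℍ × ℍ) × ℍ) × (Fol L → ℍ), (ξ.1.1.1.re ∈ Ioo (0 : ℝ) 1 ∧ ξ.1.1.2.re ∈ Ioo (0 : ℝ) 1 ∧ ξ.1.2.re ∈ Ioo (0 : ℝ) 1 ∧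
      ∀ i, (ξ.2 i).re ∈ Ioo (0 : ℝ) 1) → twoScalePhi L 0 0 a₀ ξ.1 ξ.2 < r → ξ ∈ S) :
    0 < ((volume : Measure ((ℍ × ℍ) × ℍ)).prod (Measure.pi fun _ : Fol L => (volume : Measure ℍ))) S := by
  haveI : ((volume : Measure ((ℍ × ℍ) × ℍ)).prod (Measure.pi fun _ : Fol L => (volume : Measure ℍ))).IsOpenPosMeasure :=
    Measure.prod.instIsOpenPosMeasure
  set c : ℝ := 1 / 2 with hcdef
  have hc : 0 < c := by norm_num
  have hc1 : c ∈ Ioo (0 : ℝ) 1 := ⟨hc, by norm_num⟩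
  set ξs : ((ℍ × ℍ) × ℍ) × (Fol L → ℍ) := ((((c : ℍ), (c : ℍ)), (c : ℍ)), fun _ => (c : ℍ)) with hξs
  have hc0 : ((c : ℝ) : ℍ).re ≠ 0 := by simpa using hc.ne'
  -- the open conditions
  have hre : Continuous fun v : ℍ => v.re := Quaternion.continuous_re
  set O : Set (((ℍ × ℍ) × ℍ) × (Fol L → ℍ)) := {ξ | ξ.1.1.1.re ∈ Ioo (0 : ℝ) 1 ∧ ξ.1.1.2.re ∈ Ioo (0 : ℝ) 1 ∧ ξ.1.2.re ∈ Ioo (0 : ℝ) 1 ∧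
      ∀ i, (ξ.2 i).re ∈ Ioo (0 : ℝ) 1} with hO
  have hOopen : IsOpen O := by
    have h4 : IsOpen {ξ : ((ℍ × ℍ) × ℍ) × (Fol L → ℍ) | ∀ i, (ξ.2 i).re ∈ Ioo (0 : ℝ) 1} := by
      rw [Set.setOf_forall]
      exact isOpen_iInter_of_finite fun i => isOpen_Ioo.preimage (hre.comp ((continuous_apply i).comp continuous_snd))
    exact ((isOpen_Ioo.preimage (hre.comp (continuous_fst.comp (continuous_fst.comp continuous_fst)))).inter
      ((isOpen_Ioo.preimage (hre.comp (continuous_snd.comp (continuous_fst.comp continuous_fst)))).inter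
      ((isOpen_Ioo.preimage (hre.comp (continuous_snd.comp continuous_fst))).inter h4)))
  have hcre : ((c : ℝ) : ℍ).re = c := rfl
  have hξO : ξs ∈ O := by
    simp only [hO, hξs, Set.mem_setOf_eq, hcre]
    exact ⟨hc1, hc1, hc1, fun _ => hc1⟩
  -- `{Φ < r}` is a neighbourhood of `ξ⋆`
  have hcont := continuousAt_twoScalePhi_fibre (L := L) 0 0 ha₀ (ξ := ξs) hc0 hc0 hc0 (fun _ => hc0)
  have hval : twoScalePhi L 0 0 a₀ ξs.1 ξs.2 = 0 := twoScalePhi_zero_zero_coe hc ha₀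
  have hnhds : (fun ξ' : ((ℍ × ℍ) × ℍ) × (Fol L → ℍ) => twoScalePhi L 0 0 a₀ ξ'.1 ξ'.2) ⁻¹' Iio r ∈ 𝓝 ξs :=
    hcont.preimage_mem_nhds (by rw [hval]; exact Iio_mem_nhds hr)
  obtain ⟨U, hUsub, hUopen, hξU⟩ := mem_nhds_iff.1 (Filter.inter_mem (hOopen.mem_nhds hξO) hnhds)
  calc (0 : ℝ≥0∞) < ((volume : Measure ((ℍ × ℍ) × ℍ)).prod (Measure.pi fun _ : Fol L => (volume : Measure ℍ))) U :=
        hUopen.measure_pos _ ⟨ξs, hξU⟩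
    _ ≤ _ := measure_mono fun ξ hξ => hS ξ (hUsub hξ).1 (hUsub hξ).2

/-- ★ **Positivity of `∫M`**: a measurable profile, positive at every `a ∈ (−1,1) ∖ {0}` and with finite integral, has `0 < (∫⁻_{(−1,1)} 4π·M).toReal`. [folklore] -/
theorem toReal_lintegral_pos_of_pos {M : ℝ → ℝ≥0∞} (hM : Measurable M) (hpos : ∀ a ∈ Ioo (-1 : ℝ) 1, a ≠ 0 → 0 < M a)
    (hfin : ∫⁻ a in Ioo (-1 : ℝ) 1, ENNReal.ofReal (4 * Real.pi) * M a ∂volume ≠ ∞) :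
    0 < (∫⁻ a in Ioo (-1 : ℝ) 1, ENNReal.ofReal (4 * Real.pi) * M a ∂volume).toReal := by
  refine ENNReal.toReal_pos ?_ hfin
  intro h0
  have hae := (lintegral_eq_zero_iff (measurable_const.mul hM)).1 h0
  rw [Filter.EventuallyEq, ae_restrict_iff' measurableSet_Ioo] at hae
  have hnull : (volume : Measure ℝ) (Ioo (0 : ℝ) 1) = 0 := by
    refine measure_mono_null (fun a ha => ?_) (ae_iff.1 hae)
    simp only [Set.mem_setOf_eq, Pi.zero_apply, Classical.not_imp]
    have ha' : a ∈ Ioo (-1 : ℝ) 1 := ⟨by linarith [ha.1], ha.2⟩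
    refine ⟨ha', mul_ne_zero (ENNReal.ofReal_pos.2 (by positivity)).ne' (hpos a ha' ha.1.ne').ne'⟩
  rw [Real.volume_Ioo] at hnull
  norm_num at hnull

end Summit.QuantumFields.YangMills.Theorems.SwapVirialDeficit.BlowUpRing

end
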